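import Mathlib
import HarnessLib
import Summits.HubbardSuperconductivity.HubbardSuperconductivity.Theorems.KLProgrammeKLRegimeTwoVolumeTorusBlocks
import Literature.MathematicalPhysics.QuantumLattice.GrassmannEffectiveActionCopies

/-!
# Route `KLProgramme` — crux K3, the nested two-volume pass (β′): GLUING the on-site grid interactions — the `b²` embedded copies of the coarse Hubbard
# grid interaction / quadratic term ARE the fine ones (cell gate-hubbard-kl, seat hubbard-kl-k3c4-p1 g7)

For a block structure `e : GridLeg (GridPoint Lf N) ≃ (Fin 2 → Fin b) × GridLeg (GridPoint L N)` of the grid legs with block `⌊x/L⌋` and projection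
`(((j,x),σ),c) ↦ (((j, red x),σ),c)` (`…TwoVolumeTorusBlocks.exists_gridLegBlockEquiv`) and block embeddings `f_β` (`GrassmannEffectiveActionCopies`):

* `gridLeg_symm_proj`, `gridLeg_symm_components`, `gridLeg_symm_site_eq` — the lifted leg `e⁻¹(β, Y)` has the time/spin/charge of `Y` and a site
  depending only on `(β, site Y)`;
* `map_blockEmb_gridWord`, `map_blockEmb_pairWord` — an embedded grid word / density word is the fine word at the lifted grid point;
* `exists_gridPointBlockEquiv` — the induced bijection `(Fin 2 → Fin b) × GridPoint L N ≃ GridPoint Lf N` of grid POINTS;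
* **`sum_map_blockEmb_hubbardGridInteraction`**, **`sum_map_blockEmb_hubbardGridQuadratic`** — `Σ_β (V_L ∘ f_β) = V_{Lf}` for the quartic on-site
  interaction and for the local quadratic term: the glued interaction of `GrassmannEffectiveActionCopies.effAction_copies_sum` IS the fine torus's
  interaction (BETA-PRIME-ROADMAP (m1): no interaction defect for on-site vertices).

Sorry-free; no definition.  References: BETA-PRIME-ROADMAP.md (k3c5-p2 g5) (m1); Salmhofer 1999 §4.2.4 (4.58).
-/

noncomputable section

namespace Summit.HubbardSuperconductivity.HubbardSuperconductivity.Theorems.TwoVolumeDefect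

set_option linter.dupNamespace false -- summit = problem name (single-conjunct summit), D-0017

open Finset Literature.MathematicalPhysics.QuantumLattice GrassmannAlgebra Literature.Probability.LatticeModels

variable {b L Lf N : ℕ} [NeZero Lf] [NeZero L]
  (e : GridLeg (GridPoint Lf N) ≃ (Fin 2 → Fin b) × GridLeg (GridPoint L N))

/-! ## §1 Components of a lifted leg -/

omit [NeZero Lf] [NeZero L] in
/-- The lifted leg `e⁻¹(β, Y)` projects to `Y`. [folklore] -/
theorem gridLeg_symm_proj (he2 : ∀ X', (e X').2 = (((X'.1.1.1, fun i => (((X'.1.1.2 i).val : ℕ) : ZMod L)), X'.1.2), X'.2))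
    (β : Fin 2 → Fin b) (Y : GridLeg (GridPoint L N)) :
    ((((e.symm (β, Y)).1.1.1, fun i => ((((e.symm (β, Y)).1.1.2 i).val : ℕ) : ZMod L)), (e.symm (β, Y)).1.2), (e.symm (β, Y)).2) = Y := by
  rw [← he2, Equiv.apply_symm_apply]

omit [NeZero Lf] [NeZero L] in
/-- Time, spin and charge of the lifted leg are those of `Y`; its site reduces to the site of `Y`. [folklore] -/
theorem gridLeg_symm_components (he2 : ∀ X', (e X').2 = (((X'.1.1.1, fun i => (((X'.1.1.2 i).val : ℕ) : ZMod L)), X'.1.2), X'.2))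
    (β : Fin 2 → Fin b) (Y : GridLeg (GridPoint L N)) :
    (e.symm (β, Y)).1.1.1 = Y.1.1.1 ∧ (fun i => ((((e.symm (β, Y)).1.1.2 i).val : ℕ) : ZMod L)) = Y.1.1.2 ∧
      (e.symm (β, Y)).1.2 = Y.1.2 ∧ (e.symm (β, Y)).2 = Y.2 := by
  have h := gridLeg_symm_proj e he2 β Y
  simp only [Prod.ext_iff] at h
  exact ⟨h.1.1.1, h.1.1.2, h.1.2, h.2⟩

omit [NeZero Lf] [NeZero L] in
/-- The block of the lifted leg is `β`. [folklore] -/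
theorem gridLeg_symm_block (β : Fin 2 → Fin b) (Y : GridLeg (GridPoint L N)) : (e (e.symm (β, Y))).1 = β := by
  rw [Equiv.apply_symm_apply]

omit [NeZero L] in
/-- **The site of the lifted leg depends only on the block and on the site of `Y`.** [folklore] -/
theorem gridLeg_symm_site_eq (he1 : ∀ X' i, ((e X').1 i : ℕ) = (X'.1.1.2 i).val / L)
    (he2 : ∀ X', (e X').2 = (((X'.1.1.1, fun i => (((X'.1.1.2 i).val : ℕ) : ZMod L)), X'.1.2), X'.2))
    (β : Fin 2 → Fin b) {Y₁ Y₂ : GridLeg (GridPoint L N)} (hY : Y₁.1.1.2 = Y₂.1.1.2) :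
    (e.symm (β, Y₁)).1.1.2 = (e.symm (β, Y₂)).1.1.2 := by
  have h1 := (gridLeg_symm_components e he2 β Y₁).2.1
  have h2 := (gridLeg_symm_components e he2 β Y₂).2.1
  funext i
  refine apply_eq_of_red_eq_of_block_eq (m := L) ?_ ?_
  · have := congr_fun h1 i
    have h' := congr_fun h2 i
    rw [this, h', hY]
  · rw [← he1, ← he1, gridLeg_symm_block, gridLeg_symm_block]

/-! ## §2 Embedded words -/

/-- **An embedded grid word is the fine grid word at the lifted point.** [folklore] -/
theorem map_blockEmb_gridWord (he1 : ∀ X' i, ((e X').1 i : ℕ) = (X'.1.1.2 i).val / L)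
    (he2 : ∀ X', (e X').2 = (((X'.1.1.1, fun i => (((X'.1.1.2 i).val : ℕ) : ZMod L)), X'.1.2), X'.2))
    {β : Fin 2 → Fin b} {f : (GridLeg (GridPoint L N) → ℂ) →ₗ[ℂ] (GridLeg (GridPoint Lf N) → ℂ)}
    (hf : ∀ v X', f v X' = if (e X').1 = β then v (e X').2 else 0) (p : GridPoint L N) :
    ExteriorAlgebra.map f (gridWord L N p) = gridWord Lf N (p.1, (e.symm (β, ((p, 0), 0))).1.1.2) := by
  have hleg : ∀ (σ c : Fin 2), e.symm (β, ((p, σ), c)) = (((p.1, (e.symm (β, ((p, 0), 0))).1.1.2), σ), c) := by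
    intro σ c
    obtain ⟨ht, -, hs, hc⟩ := gridLeg_symm_components e he2 β ((p, σ), c)
    have hsite := gridLeg_symm_site_eq e he1 he2 β (Y₁ := ((p, σ), c)) (Y₂ := ((p, 0), 0)) rfl
    exact Prod.ext (Prod.ext (Prod.ext ht hsite) hs) hc
  generalize (e.symm (β, ((p, 0), 0))).1.1.2 = x' at hleg ⊢
  rw [gridWord, map_mul, map_mul, map_mul, map_blockEmb_gen e hf, map_blockEmb_gen e hf, map_blockEmb_gen e hf, map_blockEmb_gen e hf,
    hleg 0 0, hleg 0 1, hleg 1 0, hleg 1 1, gridWord]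

/-- An embedded density word `ψ⁺_{pσ}ψ⁻_{pσ}` is the fine one at the lifted point. [folklore] -/
theorem map_blockEmb_pairWord (he1 : ∀ X' i, ((e X').1 i : ℕ) = (X'.1.1.2 i).val / L)
    (he2 : ∀ X', (e X').2 = (((X'.1.1.1, fun i => (((X'.1.1.2 i).val : ℕ) : ZMod L)), X'.1.2), X'.2))
    {β : Fin 2 → Fin b} {f : (GridLeg (GridPoint L N) → ℂ) →ₗ[ℂ] (GridLeg (GridPoint Lf N) → ℂ)}
    (hf : ∀ v X', f v X' = if (e X').1 = β then v (e X').2 else 0) (p : GridPoint L N) (σ : Fin 2) :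
    ExteriorAlgebra.map f (gen ℂ (((p, σ), 0) : GridLeg (GridPoint L N)) * gen ℂ (((p, σ), 1) : GridLeg (GridPoint L N))) =
      gen ℂ ((((p.1, (e.symm (β, ((p, 0), 0))).1.1.2), σ), 0) : GridLeg (GridPoint Lf N)) *
        gen ℂ ((((p.1, (e.symm (β, ((p, 0), 0))).1.1.2), σ), 1) : GridLeg (GridPoint Lf N)) := by
  have hleg : ∀ c : Fin 2, e.symm (β, ((p, σ), c)) = (((p.1, (e.symm (β, ((p, 0), 0))).1.1.2), σ), c) := by
    intro c
    obtain ⟨ht, -, hs, hc⟩ := gridLeg_symm_components e he2 β ((p, σ), c)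
    have hsite := gridLeg_symm_site_eq e he1 he2 β (Y₁ := ((p, σ), c)) (Y₂ := ((p, 0), 0)) rfl
    exact Prod.ext (Prod.ext (Prod.ext ht hsite) hs) hc
  generalize (e.symm (β, ((p, 0), 0))).1.1.2 = x' at hleg ⊢
  rw [map_mul, map_blockEmb_gen e hf, map_blockEmb_gen e hf, hleg 0, hleg 1]

/-! ## §3 The induced bijection of grid points and the gluing of the interactions -/

omit [NeZero Lf] [NeZero L] in
/-- **The block structure of grid POINTS** induced by `e`: `(β, p) ↦` the point of the lifted leg `e⁻¹(β, ((p,0),0))` is a bijection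
`(Fin 2 → Fin b) × GridPoint L N ≃ GridPoint Lf N`. [folklore] -/
theorem exists_gridPointBlockEquiv (he2 : ∀ X', (e X').2 = (((X'.1.1.1, fun i => (((X'.1.1.2 i).val : ℕ) : ZMod L)), X'.1.2), X'.2)) :
    ∃ E : (Fin 2 → Fin b) × GridPoint L N ≃ GridPoint Lf N, ∀ β p, E (β, p) = (p.1, (e.symm (β, ((p, 0), 0))).1.1.2) := by
  refine ⟨{ toFun := fun q => (e.symm (q.1, ((q.2, 0), 0))).1.1
            invFun := fun p' => ((e ((p', 0), 0)).1, (e ((p', 0), 0)).2.1.1)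
            left_inv := ?_
            right_inv := ?_ }, fun β p => ?_⟩
  · rintro ⟨β, p⟩
    obtain ⟨ht, -, hs, hc⟩ := gridLeg_symm_components e he2 β ((p, 0), 0)
    have hX : (((e.symm (β, ((p, 0), 0))).1.1, (0 : Fin 2)), (0 : Fin 2)) = e.symm (β, ((p, 0), 0)) :=
      Prod.ext (Prod.ext rfl hs.symm) hc.symm
    simp only [hX, Equiv.apply_symm_apply]
  · intro p'
    have h2 := he2 ((p', 0), 0)
    have hY : (((e ((p', 0), 0)).2.1.1, (0 : Fin 2)), (0 : Fin 2)) = (e ((p', 0), 0)).2 := by rw [h2]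
    simp only [hY, Prod.mk.eta, Equiv.symm_apply_apply]
  · obtain ⟨ht, -, -, -⟩ := gridLeg_symm_components e he2 β ((p, 0), 0)
    exact Prod.ext ht rfl

/-- **The glued quartic interaction is the fine one**: `Σ_β (V_L ∘ f_β) = V_{Lf}` for `hubbardGridInteraction`. [folklore] -/
theorem sum_map_blockEmb_hubbardGridInteraction (he1 : ∀ X' i, ((e X').1 i : ℕ) = (X'.1.1.2 i).val / L)
    (he2 : ∀ X', (e X').2 = (((X'.1.1.1, fun i => (((X'.1.1.2 i).val : ℕ) : ZMod L)), X'.1.2), X'.2))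
    (Fe : (Fin 2 → Fin b) → (GridLeg (GridPoint L N) → ℂ) →ₗ[ℂ] (GridLeg (GridPoint Lf N) → ℂ))
    (hFe : ∀ β v X', Fe β v X' = if (e X').1 = β then v (e X').2 else 0) (β' U : ℝ) :
    ∑ β, ExteriorAlgebra.map (Fe β) (hubbardGridInteraction L N β' U) = hubbardGridInteraction Lf N β' U := by
  obtain ⟨E, hE⟩ := exists_gridPointBlockEquiv e he2
  simp only [hubbardGridInteraction, map_smul, map_sum, ← Finset.smul_sum]
  congr 1
  simp_rw [map_blockEmb_gridWord e he1 he2 (hFe _)]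
  calc ∑ β : Fin 2 → Fin b, ∑ p : GridPoint L N, gridWord Lf N (p.1, (e.symm (β, ((p, 0), 0))).1.1.2)
      = ∑ q : (Fin 2 → Fin b) × GridPoint L N, gridWord Lf N (E q) := by
        rw [← Fintype.sum_prod_type']
        exact Fintype.sum_congr _ _ fun q => by rw [hE q.1 q.2]
    _ = ∑ p', gridWord Lf N p' := E.sum_comp (fun p' => gridWord Lf N p')

/-- **The glued local quadratic term is the fine one**: `Σ_β (N₂^{(L)} ∘ f_β) = N₂^{(Lf)}` for `hubbardGridQuadratic`. [folklore] -/
theorem sum_map_blockEmb_hubbardGridQuadratic (he1 : ∀ X' i, ((e X').1 i : ℕ) = (X'.1.1.2 i).val / L)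
    (he2 : ∀ X', (e X').2 = (((X'.1.1.1, fun i => (((X'.1.1.2 i).val : ℕ) : ZMod L)), X'.1.2), X'.2))
    (Fe : (Fin 2 → Fin b) → (GridLeg (GridPoint L N) → ℂ) →ₗ[ℂ] (GridLeg (GridPoint Lf N) → ℂ))
    (hFe : ∀ β v X', Fe β v X' = if (e X').1 = β then v (e X').2 else 0) (β' : ℝ) :
    ∑ β, ExteriorAlgebra.map (Fe β) (hubbardGridQuadratic L N β') = hubbardGridQuadratic Lf N β' := by
  obtain ⟨E, hE⟩ := exists_gridPointBlockEquiv e he2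
  simp only [hubbardGridQuadratic, map_smul, map_sum, ← Finset.smul_sum]
  congr 1
  simp_rw [map_blockEmb_pairWord e he1 he2 (hFe _)]
  calc ∑ β : Fin 2 → Fin b, ∑ p : GridPoint L N, ∑ σ : Fin 2,
        gen ℂ ((((p.1, (e.symm (β, ((p, 0), 0))).1.1.2), σ), 0) : GridLeg (GridPoint Lf N)) *
          gen ℂ ((((p.1, (e.symm (β, ((p, 0), 0))).1.1.2), σ), 1) : GridLeg (GridPoint Lf N))
      = ∑ q : (Fin 2 → Fin b) × GridPoint L N, ∑ σ : Fin 2,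
          gen ℂ (((E q, σ), 0) : GridLeg (GridPoint Lf N)) * gen ℂ (((E q, σ), 1) : GridLeg (GridPoint Lf N)) := by
        rw [← Fintype.sum_prod_type']
        exact Fintype.sum_congr _ _ fun q => by rw [hE q.1 q.2]
    _ = ∑ p', ∑ σ : Fin 2, gen ℂ (((p', σ), 0) : GridLeg (GridPoint Lf N)) * gen ℂ (((p', σ), 1) : GridLeg (GridPoint Lf N)) :=
        E.sum_comp (fun p' => ∑ σ : Fin 2, gen ℂ (((p', σ), 0) : GridLeg (GridPoint Lf N)) * gen ℂ (((p', σ), 1) : GridLeg (GridPoint Lf N)))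

end Summit.HubbardSuperconductivity.HubbardSuperconductivity.Theorems.TwoVolumeDefect

end
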